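import Summits.ValiantsHypothesis.ValiantsHypothesis.Theses.DivisionGap
import Summits.ValiantsHypothesis.ValiantsHypothesis.Theorems.DivisionGapZeroOneTransferSparsePolyComplexity
import Literature.Computability.AlgebraicComplexity.ArithCircuitProofs

/-!
# Crux `DivisionGap.ZeroOneTransfer` (stmt-ValiantsHypothesis-5066), line `charged-uncharged` —
stub `cofactorCharging_largeCostRegime`: charging is free when the uncharged multiple is expensive

Support file for crux `stmt-ValiantsHypothesis-5066` (`Theses.DivisionGap.ZeroOneTransfer`, H2 of
route DivisionGap), line `charged-uncharged` (lead c8).  The crux splits as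
`MonotoneMultiples ∧ CofactorCharging` (`Theorems/DivisionGapZeroOneTransferSplit.lean`);
`CofactorCharging` (CC) says: for every 0/1-coefficient family `f` over `ℝ≥0` whose
complexification is in `VP_ℂ` there is `k` with, for all `n` and all nonzero cofactors `h`, a
nonzero `h'` such that `L(f_n h') + L(h') ≤ 2 ^ ((log₂ n + log₂ L(f_n h) + k) ^ k)`, where
`L = complexity` is the least size of a fan-in-two arithmetic circuit over the semiring `ℝ≥0`
(monotone circuit size; variables and constants are free).

This file records the regime of CC that is a theorem for free, the LARGE-COST regime
`2 ^ n ≤ L(f_n h)` (the uncharged multiple `f_n h` is itself exponentially expensive):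

`cofactorCharging_largeCostRegime : ∀ σ f, IsVPFamily (map f) → ∃ k, ∀ n h, 2 ^ n ≤ L(f_n h) →
   ∃ h' ≠ 0, L(f_n h') + L(h') ≤ 2 ^ ((log₂ n + log₂ L(f_n h) + k) ^ k)`.

Proof: the free cofactor `h' := 1` works (`L(1) = 0`, `L(f_n · 1) = L(f_n)`,
`LargeCostRegime.charge_of_le`), because the p-family half of `IsVPFamily` alone bounds
`L(f_n) ≤ 2 ^ poly(n)`: a polynomial of degree `D` in `V` variables has `≤ (D + 1) ^ V` monomials
(`LargeCostRegime.card_support_le_pow`), sparse polynomials are cheap (`stub_sparsePolyComplexity`,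
file `DivisionGapZeroOneTransferSparsePolyComplexity.lean`: `#supp q ≤ T → deg q ≤ T →
L(q) ≤ 2 T T + 2 T`), whence `L(f_n) ≤ 2 ^ (2 (D V + D + 1) + 2)`
(`LargeCostRegime.complexity_le_two_pow_deg_vars`); the exponent is p-bounded in `n`
(`deg f_n` is invariant under the injective coefficient map `ℝ≥0 → ℂ`,
`LargeCostRegime.totalDegree_map_of_injective`), so `≤ a (n + 1) ^ b ≤ (n + k) ^ k` for
`k := a + b + 1`; and `n ≤ log₂ L(f_n h)` in this regime.  Neither the 0/1 hypothesis, nor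
`h ≠ 0`, nor the `ℂ`-circuit bound of `VP` is used.

Consequence for the line: the content of CC is exactly the window `L(f_n h) < 2 ^ n` — a cheap
uncharged multiple of a family whose own monotone cost is super-quasi-polynomial.  Helper
namespace `LargeCostRegime`; no definitions in this file.
-/

noncomputable section

-- Sub = Summit single-conjunct layout: the duplicated namespace component is mandated by the tree.
set_option linter.dupNamespace false

namespace Summit.ValiantsHypothesis.ValiantsHypothesis.Theorems.DivisionGapZeroOneTransfer

open MvPolynomial Literature.Computability.AlgebraicComplexity
open scoped NNReal

namespace LargeCostRegime

variable {τ : Type}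

/-- Charging by the free cofactor `h' := 1`: if `L(f) ≤ B` then `f` is charged within `B`
(`L(1) = L(C 1) = 0`, constants are free). [folklore] -/
theorem charge_of_le (f : MvPolynomial τ ℝ≥0) {B : ℕ} (hf : complexity f ≤ B) :
    ∃ h' : MvPolynomial τ ℝ≥0, h' ≠ 0 ∧ complexity (f * h') + complexity h' ≤ B := by
  refine ⟨1, one_ne_zero, ?_⟩
  have h1 : complexity (1 : MvPolynomial τ ℝ≥0) = 0 := by
    rw [← C_1]
    exact complexity_C_holds (1 : ℝ≥0)
  rwa [mul_one, h1, add_zero]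

/-- Support count: a polynomial of total degree `D` in `|τ|` variables has `≤ (D + 1) ^ |τ|`
monomials (truncated exponent vectors `τ → Fin (D + 1)` separate the support). [folklore] -/
theorem card_support_le_pow [Fintype τ] (q : MvPolynomial τ ℝ≥0) :
    q.support.card ≤ (q.totalDegree + 1) ^ Fintype.card τ := by
  classical
  set D := q.totalDegree with hD
  let F : (τ →₀ ℕ) → (τ → Fin (D + 1)) := fun d i =>
    ⟨min (d i) D, Nat.lt_succ_of_le (min_le_right _ _)⟩
  have hinj : Set.InjOn F (q.support : Set (τ →₀ ℕ)) := by
    intro d hd d' hd' hFF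
    ext i
    have hdi : d i ≤ D :=
      (monomial_le_degreeOf i (Finset.mem_coe.1 hd)).trans (degreeOf_le_totalDegree q i)
    have hd'i : d' i ≤ D :=
      (monomial_le_degreeOf i (Finset.mem_coe.1 hd')).trans (degreeOf_le_totalDegree q i)
    have h := congrArg (fun g : τ → Fin (D + 1) => ((g i : Fin (D + 1)) : ℕ)) hFF
    simpa [F, min_eq_left hdi, min_eq_left hd'i] using h
  calc q.support.card ≤ (Finset.univ : Finset (τ → Fin (D + 1))).card :=
        Finset.card_le_card_of_injOn F (fun _ _ => Finset.mem_coe.2 (Finset.mem_univ _)) hinj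
    _ = (D + 1) ^ Fintype.card τ := by
        rw [Finset.card_univ, Fintype.card_fun, Fintype.card_fin]

/-- The trivial exponential upper bound on monotone complexity: `L(q) ≤ 2 ^ (2 (D·V + D + 1) + 2)`
for `D = deg q`, `V = |τ|` (write `q` as the sum of its `≤ (D+1)^V` monomials;
`stub_sparsePolyComplexity`). No hypothesis on the coefficients. [folklore] -/
theorem complexity_le_two_pow_deg_vars [Fintype τ] (q : MvPolynomial τ ℝ≥0) :
    complexity q ≤
      2 ^ (2 * (q.totalDegree * Fintype.card τ + q.totalDegree + 1) + 2) := by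
  set D := q.totalDegree with hD
  set V := Fintype.card τ with hV
  set M := (D + 1) ^ V + D with hM
  have hsupp : q.support.card ≤ M := (card_support_le_pow q).trans (Nat.le_add_right _ _)
  have hdeg : q.totalDegree ≤ M := Nat.le_add_left _ _
  have hL : complexity q ≤ 2 * M * M + 2 * M := stub_sparsePolyComplexity τ M q hsupp hdeg
  set m := D * V + D + 1 with hm
  have h1 : (D + 1) ^ V ≤ 2 ^ (D * V) := by
    calc (D + 1) ^ V ≤ (2 ^ D) ^ V := Nat.pow_le_pow_left Nat.lt_two_pow_self V
      _ = 2 ^ (D * V) := by rw [← pow_mul]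
  have h2 : D ≤ 2 ^ D := (Nat.lt_two_pow_self).le
  have hMle : M ≤ 2 ^ m := by
    calc M = (D + 1) ^ V + D := rfl
      _ ≤ 2 ^ (D * V) + 2 ^ D := Nat.add_le_add h1 h2
      _ ≤ 2 ^ (D * V + D) + 2 ^ (D * V + D) :=
          Nat.add_le_add (Nat.pow_le_pow_right two_pos (Nat.le_add_right _ _))
            (Nat.pow_le_pow_right two_pos (Nat.le_add_left _ _))
      _ = 2 ^ m := by rw [hm, pow_succ]; ring
  have hM1 : 1 ≤ M := by
    have : 1 ≤ (D + 1) ^ V := Nat.one_le_pow _ _ (Nat.succ_pos D)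
    omega
  calc complexity q ≤ 2 * M * M + 2 * M := hL
    _ ≤ 2 * M * M + 2 * M * M := by
        refine Nat.add_le_add_left ?_ _
        simpa using Nat.mul_le_mul_left (2 * M) hM1
    _ = 4 * (M * M) := by ring
    _ ≤ 4 * (2 ^ m * 2 ^ m) := Nat.mul_le_mul_left 4 (Nat.mul_le_mul hMle hMle)
    _ = 2 ^ (2 * m + 2) := by
        rw [show (4 : ℕ) = 2 ^ 2 from rfl, ← pow_add, ← pow_add]; congr 1; omega

/-- Total degree is invariant under an injective change of coefficients. [folklore] -/
theorem totalDegree_map_of_injective {R S : Type*} [CommSemiring R] [CommSemiring S]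
    {φ : R →+* S} (hφ : Function.Injective φ) (p : MvPolynomial τ R) :
    (MvPolynomial.map φ p).totalDegree = p.totalDegree := by
  rw [totalDegree, totalDegree, support_map_of_injective p hφ]

/-- **LARGE-COST REGIME** (explicit-argument form).  For a family whose complexification is a
p-family (only the first half of `IsVPFamily` is used — neither 0/1 coefficients nor the
`ℂ`-circuit bound) there is `k` such that every cofactor `h` with `2 ^ n ≤ L(f_n h)` is charged
by the free cofactor `h' := 1`: the trivial bound `L(f_n) ≤ 2 ^ poly(n)`
(`complexity_le_two_pow_deg_vars`) is then already quasi-polynomial in `L(f_n h)`. [folklore] -/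
theorem charging_in_exp_regime (σ : ℕ → Type) [∀ n, Fintype (σ n)]
    (f : ∀ n, MvPolynomial (σ n) ℝ≥0)
    (hVP : IsVPFamily (k := ℂ)
      (fun n => MvPolynomial.map (Complex.ofRealHom.comp NNReal.toRealHom) (f n))) :
    ∃ k : ℕ, ∀ n, ∀ h : MvPolynomial (σ n) ℝ≥0, 2 ^ n ≤ complexity (f n * h) →
      ∃ h' : MvPolynomial (σ n) ℝ≥0, h' ≠ 0 ∧ complexity (f n * h') + complexity h' ≤
        2 ^ ((Nat.log 2 n + Nat.log 2 (complexity (f n * h)) + k) ^ k) := by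
  obtain ⟨⟨hV, hD⟩, -⟩ := hVP
  have hφ : Function.Injective (Complex.ofRealHom.comp NNReal.toRealHom) :=
    Complex.ofReal_injective.comp NNReal.coe_injective
  have hD' : IsPBounded fun n => (f n).totalDegree :=
    hD.mono fun n => (totalDegree_map_of_injective hφ (f n)).symm.le
  have hE : IsPBounded fun n =>
      2 * ((f n).totalDegree * Fintype.card (σ n) + (f n).totalDegree + 1) + 2 :=
    IsPBounded.add_holds
      (IsPBounded.mul_holds (IsPBounded.const 2)
        (IsPBounded.add_holds (IsPBounded.add_holds (IsPBounded.mul_holds hD' hV) hD')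
          (IsPBounded.const 1)))
      (IsPBounded.const 2)
  obtain ⟨a, b, hab⟩ := (IsPBounded.iff_exists_le_mul_succ_pow _).1 hE
  refine ⟨a + b + 1, fun n h hL => charge_of_le (f n) ?_⟩
  have hlog : n ≤ Nat.log 2 (complexity (f n * h)) := Nat.le_log_of_pow_le one_lt_two hL
  have hpoly : a * (n + 1) ^ b ≤ (n + (a + b + 1)) ^ (a + b + 1) := by
    have h1 : (n + 1) ^ b ≤ (n + (a + b + 1)) ^ b := Nat.pow_le_pow_left (by omega) b
    have h2 : a ≤ (n + (a + b + 1)) ^ (a + 1) := by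
      calc a ≤ n + (a + b + 1) := by omega
        _ = (n + (a + b + 1)) ^ 1 := (pow_one _).symm
        _ ≤ (n + (a + b + 1)) ^ (a + 1) := Nat.pow_le_pow_right (by omega) (by omega)
    calc a * (n + 1) ^ b ≤ (n + (a + b + 1)) ^ (a + 1) * (n + (a + b + 1)) ^ b :=
          Nat.mul_le_mul h2 h1
      _ = (n + (a + b + 1)) ^ (a + b + 1) := by
          rw [← pow_add]; congr 1; omega
  calc complexity (f n)
      ≤ 2 ^ (2 * ((f n).totalDegree * Fintype.card (σ n) + (f n).totalDegree + 1) + 2) :=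
        complexity_le_two_pow_deg_vars (f n)
    _ ≤ 2 ^ (a * (n + 1) ^ b) := Nat.pow_le_pow_right two_pos (hab n)
    _ ≤ 2 ^ ((n + (a + b + 1)) ^ (a + b + 1)) := Nat.pow_le_pow_right two_pos hpoly
    _ ≤ 2 ^ ((Nat.log 2 n + Nat.log 2 (complexity (f n * h)) + (a + b + 1)) ^ (a + b + 1)) :=
        Nat.pow_le_pow_right two_pos (Nat.pow_le_pow_left (by omega) _)

end LargeCostRegime

/-- **CofactorCharging in the large-cost regime (stub `cofactorCharging_largeCostRegime` of line
`charged-uncharged`).**  For every family `f` over `ℝ≥0` whose complexification is in `VP_ℂ`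
there is `k` such that, for all `n` and every cofactor `h` whose uncharged multiple is expensive,
`2 ^ n ≤ L(f_n h)`, some nonzero `h'` (namely `h' := 1`) satisfies
`L(f_n h') + L(h') ≤ 2 ^ ((log₂ n + log₂ L(f_n h) + k) ^ k)`: the p-family half of `VP` gives
`L(f_n) ≤ 2 ^ poly(n) ≤ 2 ^ ((n + k) ^ k)` and `n ≤ log₂ L(f_n h)`.  So the content of
`CofactorCharging` is the window `L(f_n h) < 2 ^ n`. [folklore] -/
theorem cofactorCharging_largeCostRegime : ∀ (σ : ℕ → Type) [∀ n, Fintype (σ n)] (f : ∀ n, MvPolynomial (σ n) NNReal), Literature.Computability.AlgebraicComplexity.IsVPFamily (k := ℂ) (fun n => MvPolynomial.map (Complex.ofRealHom.comp NNReal.toRealHom) (f n)) → ∃ k : ℕ, ∀ n, ∀ h : MvPolynomial (σ n) NNReal, 2 ^ n ≤ Literature.Computability.AlgebraicComplexity.complexity (f n * h) → ∃ h' : MvPolynomial (σ n) NNReal, h' ≠ 0 ∧ Literature.Computability.AlgebraicComplexity.complexity (f n * h') + Literature.Computability.AlgebraicComplexity.complexity h' ≤ 2 ^ ((Nat.log 2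 n + Nat.log 2 (Literature.Computability.AlgebraicComplexity.complexity (f n * h)) + k) ^ k) := by
  intro σ _ f hVP
  exact LargeCostRegime.charging_in_exp_regime σ f hVP

end Summit.ValiantsHypothesis.ValiantsHypothesis.Theorems.DivisionGapZeroOneTransfer

end
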